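import Summits.RiemannHypothesis.RiemannHypothesis.Theorems.SignConeSignConeOscillatoryStubExtremalExists
import Literature.NumberTheory.LFunctions.UniformWeilPositivityRH

/-!
# The sign-cone value under Weil positivity / RH: unit slack `1 ≤ m(a)` (stmt-RiemannHypothesis-16302)

The crux `SignConeOscillatory` is `∀ a > 0, 0 ≤ m(a)` (`signConeOscillatory_iff_coneValue_nonneg`), where
`m(a) = coneValue a = inf {Re W_ar(g ⋆ g̃) + 1 : g admissible at cutoff a}`.  Here: Weil positivity on the window
`[-a, a]` gives `1 ≤ m(a)`, hence `RiemannHypothesis → ∀ a > 0, 1 ≤ m(a)` by Weil's criterion in the tree's form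
`riemannHypothesis_iff_forall_weilPositivityOn` — the "unit slack" of the route is the gap between this `1` and the crux's `0`.
-/

noncomputable section

-- `Summit.RiemannHypothesis.RiemannHypothesis.…` repeats a namespace component by design (D-0017 layout).
set_option linter.dupNamespace false

open MeasureTheory Set Complex

namespace Summit.RiemannHypothesis.RiemannHypothesis.Theorems.SignCone.DualWitness

open Literature.NumberTheory.LFunctions

/-- **Unit slack under Weil positivity on the window: `WeilPositivityOn a → 1 ≤ m(a)`** (for an admissible test,
`reWar (g ⋆ g̃) = Re Q(g) + Re P_Λ(g ⋆ g̃) ≥ Re Q(g) ≥ 0`). Compare the crux `⇔ ∀ a > 0, 0 ≤ m(a)`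
(`signConeOscillatory_iff_coneValue_nonneg`). [folklore] -/
theorem one_le_coneValue_of_weilPositivityOn {a : ℝ} (ha : 0 < a) (h : WeilPositivityOn a) : 1 ≤ coneValue a := by
  refine le_csInf (valueSet_nonempty ha) ?_
  rintro x ⟨g, hg, rfl⟩
  have h1 : 0 ≤ (weilQuadratic g).re := h g hg.1 hg.2.1
  have h2 := weilQuadratic_re_le_reWar hg.1 hg.2.1 (fun n hn => by
    have := hg.2.2.2 n hn; rwa [autocorr_eq_weilConv] at this)
  linarith

/-- **Unit slack under RH: `RiemannHypothesis → ∀ a > 0, 1 ≤ m(a)`** (Weil's criterion in the tree's unconditional form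
`riemannHypothesis_iff_forall_weilPositivityOn`), versus the crux `SignConeOscillatory ⇔ ∀ a > 0, 0 ≤ m(a)`. [folklore] -/
theorem one_le_coneValue_of_riemannHypothesis : RiemannHypothesis → ∀ {a : ℝ}, 0 < a → 1 ≤ coneValue a :=
  fun hRH _ ha => one_le_coneValue_of_weilPositivityOn ha (riemannHypothesis_iff_forall_weilPositivityOn.mp hRH _ ha)

end Summit.RiemannHypothesis.RiemannHypothesis.Theorems.SignCone.DualWitness

end
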